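import Mathlib
import HarnessLib
import HarnessLib.Audit
import Summits.FinalStateConjecture.Statement
import Summits.FinalStateConjecture.FinalStateConjecture.Theorems.ClusterCompletenessAssembly

/-!
Route: ClusterCompleteness

DORMANT since 2026-09-03T12:30:46Z (reconciler: no traction for 5 d (last activity statement-checked at 2026-08-29T11:45:39Z); parked, not closed — `ledger route dormant route-FinalStateConjecture-ClusterCompleteness --off` to reactivat) — unstaffed, not closed; items shared with open routes are served there. `ledger route dormant <id> --off` reactivates.

# Route ClusterCompleteness — Black holes as clusters — recurrent multi-Kerr capture by a Graf-glued
multi-centred Morawetz multiplier (N-body asymptotic completeness transplant)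

It suffices to show X = RecurrentMultiKerrCapture: there is an order k such that for EVERY
admissible vacuum datum
and every maximal vacuum Cauchy development of it, if the development admits late charts of
final-state shape — N hole
charts on boosted sub-extremal Kerr exteriors, one flat chart on the late half-space minus sublinear
tubes around the
holes' straight world-lines, the charted exterior O = J⁺(Σ) ∩ I⁻(charts) exhausted for every τ₁ > τ₀
by certified near zones
{rᵢ ≤ Rᵢ(τ)} with HONEST radii (Rᵢ → ∞, Rᵢ(τ) ≥ max(r₊,0) + 1) and flat slabs in the causal sense of
`HasExhaustiveCharts`, every
future-complete normalised null ray from Σ staying in closure O (`RaysStayInClosure`: the charts are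
not the witness's to place),
chart time FUTURE-ORIENTED (orthochronous motions; the push-forward of ∂₀ under the flat chart
future-directed on every late flat
slab), the holes separating (truncated tubes eventually disjoint for every radius, the Statement's
`exists_pairwise_disjoint`) —
which are uniformly C⁰-ANCHORED at all late chart times (metric deviation ≤ 1/4 on every flat slab
and every certified near-zone
slab: chart time ≍ proper time, honest spacelike slabs) and in which Cᵏ-closeness ≤ ε to this
receding multi-Kerr configuration
RECURS at arbitrarily late chart times for every ε > 0 and out to every fixed near-zone radius, the
push-forwards of the transported
Kerr future timelike fields Λᵢ V_{Mᵢ,aᵢ} being future-directed on the recurrent near-zone slabs (a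
receding, future-oriented
multi-Kerr state is an ω-limit point of a coarsely bounded orbit), then the development has complete
future null infinity and
settles down in the sense of the RE-TYPED Statement (C² sub-extremal final-state decomposition d of
its self-determined exterior
O′ = exteriorOf d.charted, RaysStayInClosure O′, HasExhaustiveCharts d with honest radii,
IsFutureOriented d). [rev 16: interface
repaired per the refuter's C′ (F1 closeness to every fixed radius, F2 uniform C⁰ anchor, F3
separation) after the `misstated` verdict
on the rev-11 form. rev 21 (route-repair after the Statement re-type T2, p126844): the Statement's
three new clauses — honest radii,
rays stay in closure O, future orientation — are PRE-PHASE content (where the charts sit, which way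
chart time runs) and enter
the recurrence INTERFACE (hypothesis of X = recur-disjunct of OmegaLimitMultiKerr, verbatim equal),
the conclusion is the new
settle matrix verbatim, and genericity in OmegaLimitMultiKerr is the TAME notion
`IsTameChristodoulouGeneric`; X thereby stays an
exterior late-phase statement.] This is the card nbody-asymptotic-completeness-graf-field read as
"ω-limit point ⇒ limit": the
late-phase engine (one Graf-glued, time-dependent multi-centred Morawetz/ILED multiplier +
propagation estimates on STRICTLY
RECEDING multi-Kerr backgrounds, its positivity between the holes being the Doppler red-shift of
recession) is what turns
recurrence into convergence with complete 𝓘⁺; inside the route the engine is the rank-2 crux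
AdiabaticMultiKerrILED and the
upgrade "engine ⇒ X" is the rank-3 crux LinearToNonlinearCapture, so the target is concluded by
items. The other half of the
summit — tame-generically, every maximal development that does not already settle down REACHES such
anchored, oriented recurrent
closeness (existence of an MGHD, weak cosmic censorship up to the late phase, mergers,
identification of ω-limit points, a coarse
orbital bound; the LaSalle / dissipation-budget cards' mechanisms) — is CLAIMED by this route as its
crux OmegaLimitMultiKerr
(binder h₉ of `closes`), in dichotomy form (stated for every k; implied by the Statement itself
because the settle branch makes it
vacuous — certificate omega_of_statement, Sketch.lean rc 0 against the re-typed Statement); X and it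
compose to the Statement by
monotonicity of TAME Christodoulou genericity in the property (the same end e and family F through
an exceptional datum work) and
one proof by contradiction (`closes`, 8 lines, elaborated; the two interface terms are verbatim
equal).
Lean: `∃ k : ℕ, ∀ X …, ∀ D ∈ admissibleVacuumData X, ∀ 𝒟 : VacuumCauchyDevelopment D, 𝒟.IsMaximal →
(∃ O N M a mo τ₀ Ψ ρ R U₀ Ψ₀, (∀ i, Kerr.IsSubextremal (M i) (a i)) ∧ (∀ i, IsLateChart
(boostedKerrBackground …) O τ₀ (Ψ i)) ∧ IsLateChart (Minkowski.backgroundOn U₀) O τ₀ Ψ₀ ∧ (ρᵢ/t → 0)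
∧ (∀ i, Rᵢ → ∞ ∧ ∀ τ, max (Kerr.rPlus (M i) (a i)) 0 + 1 ≤ R i τ) ∧ {τ₀ < x⁰ ∧ ∀ i, ρᵢ(x⁰) < rᵢ} ⊆
U₀ ∧ (∀ R′, ∃ τ₁, Pairwise (Disjoint on i ↦ Ψ i '' truncLateRegion τ₁ R′)) ∧ O = exteriorOf 𝒟
(charted) ∧ RaysStayInClosure 𝒟 O ∧ (∀ τ₁ > τ₀, O \ certifiedLate R τ₁ ⊆ J⁻(certifiedSlab R τ₁)) ∧
((∀ i, IsOrthochronous (mo i).1) ∧ ∀ τ > τ₀, ∀ x ∈ flat timeSlab τ, IsFutureDirected (mfderiv Ψ₀ x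
∂₀)) ∧ (∀ τ > τ₀, deviationCk flat Ψ₀ 0 τ ≤ 1/4 ∧ ∀ i, truncDeviationCk holeᵢ (Ψ i) 0 (Rᵢ τ) τ ≤
1/4) ∧ ∀ R′, ∀ ε > 0, ∃ᶠ τ in atTop, deviationCk flat Ψ₀ k τ ≤ ε ∧ ∀ i, truncDeviationCk holeᵢ (Ψ i)
k R′ τ ≤ ε ∧ ∀ x ∈ truncTimeSlabᵢ R′ τ, IsFutureDirected (mfderiv (Ψ i) x (Λᵢ (Kerr.timeVector (M i)
(a i) (poincareInv Λᵢ cᵢ x))))) → HasCompleteNullInfinity 𝒟 ∧ ∃ O (d : FinalStateDecomposition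
𝒟.toSpacetime O 2), (∀ i, Kerr.IsSubextremal (d.mass i) (d.spin i)) ∧ O = exteriorOf 𝒟 d.charted ∧
RaysStayInClosure 𝒟 O ∧ HasExhaustiveCharts d ∧ IsFutureOriented d` (full term = item
RecurrentMultiKerrCapture; elaborated rc 0 in Sketch.lean)

## Assembly
Pure logic. OmegaLimitMultiKerr at the order k produced by RecurrentMultiKerrCapture says the
property
"(∃ MGHD) ∧ ∀ MGHD, (does not settle down in the sense of the re-typed Statement) → anchored,
oriented recurrent multi-Kerr closeness
in Cᵏ" is tame-Christodoulou-generic in the admissible class; RecurrentMultiKerrCapture turns that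
recurrence into settling pointwise
(per datum, per development), so a non-settling generic development is contradictory; tame
genericity is monotone in the property
(the same end and one-parameter family through an exceptional datum work: the witness is the 8-tuple
⟨e, F, tame, immersed,
F 0 = d, injective, admissible, escape⟩). That is the whole proof of `closes` (elaborated against
the re-typed Statement, rc 0; the
item Assembly := AdiabaticMultiKerrILED → LinearToNonlinearCapture → OmegaLimitMultiKerr →
FinalStateConjecture is literally the type
of `closes`, X being derived inside it as h₃ h₂). Inside the route the target is reached through
items: AdiabaticMultiKerrILED
(rank 2, the linear engine) → RecurrentMultiKerrCapture is the rank-3 crux LinearToNonlinearCapture;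
RecurrentlyFlatDisperses
(rank 5) is the N = 0 sub-case of X (certificate x_imp_b); RecedingDopplerBudget (support) is the
geometric-optics skeleton of the
engine's ILED half. Dropped model items: MajumdarPapapetrouMorawetz (static, refuted-substantive
2026-08-15, rev 8) and
MajumdarPapapetrouLocalEnergyDecay (rate-free extremal static remnant feeding nothing on the path to
the Statement, rev 11).

Rationale: WHY THIS LINE. The card transplants the proof of asymptotic completeness for long-range N-body
systems (SigalSoffer1987; Graf1990's single vector field on configuration space, cluster-wise
dilation glued convexly across collision planes; Derezinski1993's asymptotic velocity) to the
post-merger Einstein flow with the explicit dictionary bound clusters ↦ single Kerr holes, free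
channel ↦ radiation at 𝓘⁺, Mourre estimate ↦ Morawetz/rᵖ positive-commutator estimates degenerating
at trapping, Graf's field ↦ ONE multi-centred multiplier equal to the Dafermos–Rodnianski near-zone
field (boosted Killing Tᵢ + redshift Nᵢ + Morawetz + small ωᵢΦᵢ) inside each near zone and to the
scaling/conformal field of the self-similar receding configuration {cᵢ ≈ vᵢt} far out
(arXiv:0811.0354, TataruTohaneanu2010, GiorgiKlainermanSzeftel2022), asymptotic velocity ↦ the final
boosts. Imported: Mourre–Graf–Dereziński positive-commutator technology (Mourre1981),
charge-transfer models (RodnianskiSchlagSoffer arXiv:math/0309112; Chen arXiv:1610.05226),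
Cooper–Strauss moving obstacles, propagation at normally hyperbolic trapping (WunschZworski2011),
local energy decay on TIME-DEPENDENT backgrounds (MetcalfeSterbenzTataru2017). What no prior line
does: every decay estimate on black-hole exteriors in print is single-centred (Hintz's
many-black-hole spacetimes live at Λ > 0 where expansion decouples the holes); multi-centre wave
studies are Chandrasekhar1989's two-centre set-up and numerics (arXiv:1806.07909). Relative to the
sibling route RecedingRepeller (ORBITAL ε-shadow forever ⇒ settling, complete 𝓘⁺ ASSUMED, STATIC
two-Schwarzschild resolvent gluing) this line starts from the weaker RECURRENCE hypothesis,
CONCLUDES complete 𝓘⁺, and bets on one glued TIME-DEPENDENT multiplier whose inter-hole positivity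
is the Doppler red-shift of recession (all frequencies, any N). REVISION HISTORY. rev 4–5: ray
numerics found linearly STABLE twisted inter-hole null orbits between two STATIC holes at every
separation 100M–3200M; #2 restated for STRICTLY RECEDING tails-cut configurations (survived a
crux-attack, grounded NEW). rev 8: the static model crux MajumdarPapapetrouMorawetz (stmt-10719)
refuted SUBSTANTIVELY (elliptic twisted orbits at every separation ⇒ Ralston quasimodes ⇒ no
finite-loss ILED) and dropped; next line = RECESSION, receding analogue filed as
RecedingDopplerBudget. rev 11: OmegaLimitMultiKerr CLAIMED as a crux in dichotomy form (engine +
upgrade + pre-phase: the route encompasses the whole summit); LinearToNonlinearCapture := #2 → X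
filed. rev 16: INTERFACE REPAIR after the refuter's `misstated` verdict on OmegaLimitMultiKerr
(rattack-14312: phantom holes, lagging chart time and a far-exterior flat chart made the rev-11
interface junk-satisfiable, X silently containing the ∀-data summit): F1 closeness to EVERY fixed
radius R′ with Rᵢ → ∞, F2 uniform C⁰ anchor ≤ 1/4 at ALL late chart times, F3 separation for every
radius; X, #9, #5 restated at once, `closes` unchanged. rev 17: `closes` takes (h₂ : #2) (h₃ : #3)
(h₉ : #9) and derives X as h₃ h₂ (crux-only shape); X = kind target. rev 19: RecedingDopplerBudget
restated as the refuter's C′ (launch-time binder 0 ≤ x 0 0). rev 21 (route-repair after the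
Statement RE-TYPE T2, p126844, 2026-08-16: tame genericity on one fixed end, honest near-zone radii,
intrinsic lower bound `RaysStayInClosure`, future orientation `IsFutureOriented`): (T)
OmegaLimitMultiKerr restated over `IsTameChristodoulouGeneric` — `closes` keeps its 8 lines, the
genericity witness becoming the tame 8-tuple ⟨e, F, tame, immersed, F 0 = d, inj, adm, escape⟩
(monotonicity in the property unchanged: same end, same family); (S) the settle matrix in X's and
#5's conclusions and in #9's negated disjunct is the re-typed one VERBATIM; (R) the three new
clauses are PRE-PHASE content (where the charts sit, which way chart time runs), so they enter the
recurrence INTERFACE shared verbatim by X's hypothesis and #9's recur-disjunct: honest radii Rᵢ(τ) ≥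
max(r₊,0) + 1 (the anchor then bites on a non-empty certified slab at every late time),
RaysStayInClosure of the charted exterior O, orthochronous motions with the flat chart's ∂₀
future-directed on EVERY late flat slab (timelike is automatic from the anchor; the sign is the
content), and — coupled to the recurrence times, where causality is automatic for small ε — the
push-forwards of the transported Kerr time vectors Λᵢ V_{Mᵢ,aᵢ} future-directed on the recurrent
near-zone slabs. X got weaker in hypothesis and stronger in conclusion exactly by the Statement's
own clauses; #9 is still implied by the Statement (omega_of_statement), x_imp_b (X → #5) re-proved;
Sketch.lean rc 0, 0 sorries, native preview of the gate's render certified. Texts of #2, #3, the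
budget and Assembly unchanged (#3 and Assembly follow X / #9 by name).
RANKED CRUXES. #2 AdiabaticMultiKerrILED (crux; refuter-checked, grounded NEW; unchanged) — uniform
energy boundedness (a) and integrated local energy decay with loss of one derivative (b),
∫₀^∞∫_{‖y‖≤R, outside all horizons} Σ_μ(∂_μψ)² ≤ C(E[ψ](0) + E[∂ₜψ](0)), for smooth solutions of Σ_μ
∂_μ(Σ_ν G^{μν}∂_νψ) = 0, G = η⁻¹ − Σᵢ χᵢ·2Hᵢ·(Λᵢℓᵢ♯)⊗(Λᵢℓᵢ♯), on the TAILS-CUT patched background of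
N boosted Kerr near zones in flat space: hole i exactly boosted Kerr(Mᵢ, aᵢ) for rᵢ ≤ 8Mᵢ,
attenuated by the FIXED gentle step χᵢ = smoothTransition(2 − rᵢ/8Mᵢ) (flat for rᵢ ≥ 16Mᵢ; no
annulus well), inertial motions with speeds ≤ v₀, |aᵢ| ≤ αMᵢ, separations ≥ d₀(Mᵢ + Mⱼ), PAIRWISE
STRICT RECESSION; quantifiers ∀N ∃d₀ α v₀ ∀configuration ∀R ∃C ∀ψ. [difficulty: XL] (why it might
fail: the static limit is FALSE, so C ↑ ∞ as Δv_min → 0; only the Doppler redshift of strict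
recession can give (b), and adiabatic quasimodes on the drifting island, or low-frequency energy
pumped by the moving cut-off annuli, might defeat every finite loss.) [Graf1990, arXiv:0811.0354,
DafermosRodnianski2011, MetcalfeSterbenzTataru2017, TataruTohaneanu2010, Keir2016, Ralston1969,
DolanShipley2016, arXiv:1610.05226, Ikawa1988]
#3 LinearToNonlinearCapture (crux; typed AdiabaticMultiKerrILED → RecurrentMultiKerrCapture, text
unchanged; its meaning follows X, so since rev 21 it concludes the re-typed settle matrix from the
oriented interface) — the layer-2 UPGRADE: the linear scalar engine on receding patched backgrounds
implies X (#5 is its N = 0 sub-case, an early warning rather than an input). Refuter note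
(Cert14526): modulo #2 it restates X, #2 being 'formally inert' — the tensorial TeukolskyUpgrade on
the development's near zones is the foreseen split. Content: TeukolskyUpgrade (linearised gravity
hole by hole in boosted frames inside the exact near zones, coupled through the scalar-type far
field; gluing annuli neither vacuum nor type D) and NonlinearBootstrap (GKS/DHRT-type closure around
the multi-centred ansatz restarted from a recurrence time; 10N modulated parameters + gauge;
recession Doppler budget in place of inter-hole Morawetz positivity; rᵖ-weighted smallness
MANUFACTURED from sup-norm recurrence + admissibility — the sharpest point), complete 𝓘⁺ read off
the bootstrap; rays clause and orientation of the witness decomposition inherited from the interface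
(closure O ⊆ closure O′; the sign propagates by continuity once convergence holds). [difficulty: XL]
(why it might fail: tensorial estimates on non-type-D glued annuli, nonlinear closure with a
derivative loss at trapping, weighted smallness from sup-norm recurrence, and recurrent spins αMᵢ <
|aᵢ| < Mᵢ where #2 gives nothing.) [GiorgiKlainermanSzeftel2022, KlainermanSzeftel2023,
DafermosHolzegelRodnianskiTaylor2021, arXiv:2205.14808, arXiv:2302.08916]
#0 RecurrentMultiKerrCapture (target; RESTATED rev 21 = anchored + oriented interface → re-typed
settle matrix) — X itself, as in the thesis: final-state-shaped late charts (honest radii, rays stay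
in closure O, orthochronous motions, future-directed flat chart time, separation), uniformly
C⁰-anchored, with Cᵏ ε-closeness recurring for every ε and radius and the transported Kerr time
vectors future-directed there, imply complete 𝓘⁺ and settling in the sense of the re-typed Statement
(some k; all N ≥ 0; N′, parameters, O′ existential). Concluded inside the route by #3 from #2; N = 0
sub-case = #5 (x_imp_b). [difficulty: summit-grade] (why it might fail: even anchored and oriented,
sup-norm recurrence gives no weighted control at one time — sup-small but energetic in-falling
radiation can hide at large radius between recurrence times (o₂(r⁻¹) only); and N = 1 already
contains sub-extremal Kerr stability for all |a| < M from a non-Cauchy hypothesis.) [Graf1990,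
SigalSoffer1987, Derezinski1993, GiorgiKlainermanSzeftel2022, KlainermanSzeftel2023,
DafermosHolzegelRodnianskiTaylor2021, DafermosLuk2017]
#5 RecurrentlyFlatDisperses (crux; RESTATED rev 21, the N = 0 instance of X) — the recurrence
INTERFACE isolated from the multi-centre analysis: an admissible MGHD with a flat late chart on the
WHOLE late half-space {x⁰ > τ₀} (O = exteriorOf of its image, uncharted part of O causally below
every slab, every future-complete null ray from Σ in closure O, ∂₀ pushed forward future-directed on
every late slab), C⁰-anchored on every late slab — each slab an entire spacelike, future-oriented
almost-flat hypersurface, never a far-exterior, lagging or time-reversed leaf — on which Cᵏ-flatness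
≤ ε recurs on whole slabs at arbitrarily late times, has complete 𝓘⁺ and settles down in the sense
of the re-typed Statement (expected N′ = 0). [difficulty: L–XL] (why it might fail: ∀ data,
unweighted — needs Minkowski stability from sup-norm slab flatness far below CK/LR/Bieri smallness
plus exclusion of recurrent non-decaying AF vacuum ends; one admissible MGHD recurrently sup-flat on
anchored oriented entire slabs yet not settling refutes it.) [ChristodoulouKlainerman1993,
Bieri2010JDG, LindbladRodnianski2010, AlexakisSchlue2018, Christodoulou1999]
#9 OmegaLimitMultiKerr (crux; dichotomy form rev 11, anchored rev 16, RESTATED rev 21 = tame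
genericity + re-typed settle matrix + oriented interface; rank 9 = last) — GENERIC ω-LIMIT
DICHOTOMY: for every order k, TAME-Christodoulou-generically in the admissible class (witness
families on ONE fixed end of Σ with DR rates and continuous mass, wDist-continuous and immersed at
the base datum) the datum has an MGHD and every MGHD that does not settle down in the sense of the
re-typed Statement admits anchored, oriented, separating, exhaustive, ray-complete
final-state-shaped late charts in which Cᵏ ε-closeness to a sub-extremal multi-Kerr configuration
recurs for every ε and radius (X's hypothesis verbatim). NECESSARY for the summit
(FinalStateConjecture → it for every k; omega_of_statement), hence never 'too strong', refutable
only with the Statement. CONTENT: MGHD existence; weak cosmic censorship up to the late phase with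
honest anchored charts whose exterior O swallows every future-complete null ray from Σ up to closure
(rays entering the black hole are incomplete or asymptotic to ∂O); the ℤ/2 datum that chart time
runs to the g-future; mergers; identification of ω-limit points (bound cluster = one Kerr, no
bounded chaotic N-body motion, no generic extremal limit, straight-line recession); a coarse orbital
bound; and, new with the re-type, tame witness families built on the datum's OWN end. Mechanisms on
record: cards lasalle-bondi-lyapunov-liouville, dissipation-budget-quiet-window-capture; this route
supplies the interface (compactness, not rates). [difficulty: XL, summit-grade] (why it might fail:
only with the Statement — generic data whose MGHDs neither settle nor recur so: incomplete 𝓘⁺,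
eternal bound or chaotic motion, extremal limits, non-Kerr ends, complete null rays inside black
holes; residual misstatement risk in the clauses at large k.) [DafermosLuk2017, Christodoulou1999,
Penrose1982, Klainerman2025, AlexakisSchlue2018, arXiv:1205.6112, arXiv:1302.0573]
#9 RecedingDopplerBudget (support; C′ of rev 19, unchanged) — CLASSICAL DOPPLER BUDGET on the rank-2
background: for every future-directed null bicharacteristic outside the horizons starting in the
flat region at a lab time ≥ 0, with C = C(configuration): (a′) no net blue-shift −ξ₀ ≤ C·(−ξ₀(0)) at
later flat-region points; (b′) Σ_k (T_{ι_k}-energy) ≤ C·(−ξ₀(0)) along every chain of visits to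
consecutive distinct near zones (lab energy changes only inside zones, by (1 − vⱼ·n_in)/(1 −
vⱼ·n_out); every leg towards a receding zone loses ≳ (1 − 2v₀)|Δv|; expected C ~ K + 1/((1 − 2v₀)
min|vᵢ − vⱼ|)). The geometric-optics input of the high-frequency half of #2, INFINITE for a static
pair. [difficulty: M] [Graf1990, Derezinski1993, arXiv:0811.0354, Ralston1969]
DROPPED. rev 8 — MajumdarPapapetrouMorawetz (stmt-10719; refuted-substantive): every static or
co-moving multi-hole ILED with finite loss is dead by the same orbits, never re-filed. rev 11 —
MajumdarPapapetrouLocalEnergyDecay (stmt-10146, rate-free RAGE decay): on no path to the Statement.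
TWO-LAYER PLAN. The target's layer-2 glue is FILED as #3 (typed #2 → X); foreseen split once #2
closes: #3 ⇐ TeukolskyUpgrade → NonlinearBootstrap → #3 (arXiv:2205.14808), possibly crossed with a
spin-range split (|aᵢ| ≤ αMᵢ first). Foreseen, NOT filed, inside #2: TruncatedKerrILED (N = 1) →
RecedingDopplerBudget (filed) → GluedRecessionILED → #2, only after one of them closes and only if
no child hides all difficulty (shred lint). OmegaLimitMultiKerr is not split by this route before a
mechanism card for it is routed; its crux chain owns its lines.
KILL CRITERIA. (1) EXECUTED at rev 8 (static crux refuted, line pivoted to recession). (2) The route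
closes outright (close --reason refuted:AdiabaticMultiKerrILED) if #2 is refuted for STRICTLY
receding configurations (non-summable local energy of adiabatic beams, low-frequency pumping by the
moving annuli, or failure of (a)): no late-phase linear engine of this type then exists; a
refutation of RecedingDopplerBudget (infinite transfer budget or unbounded blue-shift under pairwise
inertial recession) kills (b) at the symbol level and is treated as (2) unless the witness lives on
a ray set the PDE estimate can discard. (3) Refutation of #5 by an HONEST witness (an admissible
MGHD recurrently sup-flat on anchored, future-oriented, ray-complete entire slabs that does not
settle) kills the sup-norm interface at N = 0 and forces a PIVOT (restate X, #9, #5 together over a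
weighted one-leaf closeness once the library has hyperboloidal weighted norms), not a close; a JUNK
witness (a chart the clauses should have excluded — after rev 21 also: a time-reversed chart, an
early-empty near zone, an exterior O that a complete null ray leaves) is a misstatement, repaired on
all three items at once as at rev 16 / 21. (4) Refutation of #3 by a large-spin or loss-driven
witness forces a RESTATEMENT by regime (spin range, loss); a small-spin witness compatible with #2's
conclusions kills the line (close refuted:LinearToNonlinearCapture). (5) A proof elsewhere of the
Statement, or of X by single-centred means iterated hole by hole, moots the line (superseded). (6)
#9 is implied by the Statement: a genuine refutation decides the summit negatively (not a route
event); a MISSTATED verdict on its chart / anchor / separation / exhaustion / rays / orientation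
clauses hits the verbatim-equal hypothesis of X and is repaired on X, #9 and #5 in one edit keeping
`closes`; a further Statement re-type is handled as at rev 21.
NOT DECOMPOSED YET. (i) TeukolskyUpgrade / NonlinearBootstrap inside #3; (ii) everything inside #9 —
MGHD existence, censorship up to the late phase, 'bound cluster = one Kerr', capture, the tame
witness families on the fixed end, the interior incompleteness behind the rays clause — its crux
chain's business; (iii) a typed hyperboloidal one-leaf version of X (needs weighted norms on
multi-centred references the library lacks); (iv) constants: d₀, the derivative loss, |aᵢ| ≪ Mᵢ vs
the sub-extremal range, C ~ R/Δv_min; (v) a barrier entry 'StableInterHoleTrapping' (refuter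
territory); (vi) a PDE-level receding toy (two receding lenses), candidate tenure item; (vii)
TruncatedKerrILED (N = 1 of #2), a foreseen child; (viii) interface conventions: anchor 1/4 (any
fixed c < 1 works: it bounds the operator norm of Ψ*g − g₀ on the slab, so ∂₀ stays timelike on the
flat chart — which is why the flat orientation clause is honest at ALL late times — and slabs stay
spacelike); radii `Rᵢ → ∞ ∧ Rᵢ ≥ max(r₊,0) + 1` copied from the Statement; hole orientation asked
only at the recurrence times (causal automatic for ε below a configuration-dependent ε₀; between
recurrence times a 1/4 anchor does not force causality of Λᵢ Vᵢ for |aᵢ| ≳ 0.99Mᵢ near the horizon,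
so the Statement's 'eventually' form — right for SETTLED charts — was rejected for the interface);
the 3.3 kB interface term is duplicated verbatim in X and #9 (closed Props) — the Theorems-side
vocabulary ClusterCompletenessOmegaLimitMultiKerrDefs (Settles / Recurs / OmegaAt) must be bumped by
its provers to the rev-21 matrices (Sketch.lean's Settles' / Recurs' / RecursFlat' are the exact
texts); X's hypothesis carries no smallness of |aᵢ|/Mᵢ, of the speeds, no d₀ — the mismatch with
#2's regime lives inside #3 by design.
CHEAPEST FALSIFIER. (i) RecedingDopplerBudget: trace null bicharacteristics of the patched N = 2, 3
backgrounds hunting for chains whose telescoped Doppler product does not decay (relay cycles through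
a near-tangential pair; rays parked at a photon sphere; v₀ ≤ 0.1); expected sup gain ≤ 1 + O(v₀²), Σ
≤ (K + 1/(2Δv_min))·e₀. (ii) #2: the Gaussian beam on the drifting island is CONSISTENT with (b);
drive instead the LOW-frequency side (energy extraction from the O(v) non-stationarity of the moving
cut-off annuli) or failure of (a) through the O(v/d(t)) frame mismatch. (iii) N = 1 consistency of
#2 is free (truncated slowly rotating Kerr). (iv) #9 and the verbatim-equal hypothesis of X: only
misstatement hunting is cheap — re-run the refuter's junk levers L1–L3 (stmt-14312) and the re-type
audit's (time-REVERSED chart; Rᵢ small early, emptying the certified slab; an O that a complete null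
ray from Σ leaves) against the rev-21 clauses — each must FAIL; then N = 0 Christodoulou–Klainerman
data and N = 1 exact sub-extremal Kerr data must satisfy the SETTLE disjunct with identity charts
(Kerr: V = −g♯dt* future timelike on {r > 0}, horizon generators complete in ∂O, interior null
geodesics reach the Cauchy horizon at finite affine parameter), else the Statement's format is at
fault. (v) #3: the N = 1, a = 0 instance — does boundedness + ILED-with-loss on truncated
Schwarzschild plus sup-norm Cᵏ recurrence give DHRT-type settling? Sup-norm recurrence compatible
with an unbounded weighted energy supply from admissible o₂(r⁻¹) tails kills the
manufactured-smallness step.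
NUMBERS. SPO window of the equal-mass MP di-hole: 0.770 ≤ d/M ≤ 1.089 (DolanShipley2016 §2.2.2).
Twisted inter-hole orbits (stmt-10719): elliptic windows just below the fold at d = 2 … 640 M; L·d →
18.53, ρ₀ → 3.044M, twist → 90° per transit; tails-cut pair: reduced traces −0.129 … −1.788 at d =
100…800M. Doppler toy (stmt-13854): Σ_visits E_k/E₀ = 1/(2Δv) to 3 digits; worst sup gain 1.0006
over ~2000 receding configurations with v₀ ≤ 0.1; approaching control ×20 in 60 legs. Kerr
stability: |a|/M ≪ 1 only (KlainermanSzeftel2023);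
DEFINITION REQUESTS. Not blocking: (1) `PatchedMultiKerrBackground` bundling the inline G of #2 /
RecedingDopplerBudget (Literature/Geometry/Lorentzian, next to multiCentreKerrSchildBilin); (2)
`KerrSchild.IsNullBicharacteristic G x ξ s`, written inline in RecedingDopplerBudget; (3) foreseen:
`RecedingMultiKerrLeaf`; (4) the oriented recurrence interface as a named Literature-side predicate
next to FinalStateDecomposition (the Theorems-side `Recurs` is the de-facto one), so that X and #9
share one definition. Acquisition: Chandrasekhar1989 paywalled, acq-02892.

Novelty: Searches (2026-08-15): `lit galaxy search "Majumdar-Papapetrou" --star all` (30 rows: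
textbooks/monographs only — Chandrasekhar MTBH, Griffiths–Podolský, Heusler; pdf: charged-binary
initial data PRD 99 104044, static AdS binaries 2407.00151; nothing on wave decay); `lit galaxy
search "Majumdar-Papapetrou di-hole" --star all` (0); `lit galaxy search "multi-black-hole
spacetimes" --star all` (0, two stars timed out); `lit search --source arxiv "Majumdar-Papapetrou
wave"` (10: nearest arXiv:1806.07909 Assumpção–Cardoso–Ishibashi–Richartz–Zilhão, numerics of wave
scattering/QNMs with MP as binary proxy; 1807.10741 Wada basins; 1610.04863 two photon spheres
lensing); `lit search --source arxiv "wave equation Majumdar-Papapetrou decay"` (1: Aretakis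
1206.6598); `lit read doi:10.1103/physrevd.94.044038` (held as arXiv:1605.07193; SPO window quoted
above); `lit read doi:10.1098/rspa.1989.0010` (paywalled → acq-02892); `lit frontier
FinalStateConjecture --since 2020` (30 descendants; multi-hole items are formation/initial-data:
arXiv:2601.01517, arXiv:2409.14582 — none on late-time multi-centre decay); `lit bridges
FinalStateConjecture --cross any` (surveys only). Local index / OpenAlex / zbMATH legs unavailable
this session (searchd rc 75 ×3, OpenAlex 429); the card's own zbMATH searches ('wave equation
Majumdar-Papapetrou multi black hole decay', 'two black holes linear waves decay': 0 hits) and its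
audit (nearest PDE precedent: charge-transfer models RSS math/0309112; Soffer ICM 2  [refs: 10.1103/physrevd.94.044038`, 10.1098/rspa.1989.0010`, 1806.07909, 1605.07193, 2601.01517, 2409.14582, 1405.5304, doi:10.1103/physrevd.94.044038, doi:10.1098/rspa.1989.0010, Chandrasekhar1989, GeorgescuGerardHafner2014, Graf1990, Derezinski1993, Ikawa1988]

Barriers (technique_class: N-body-scattering-transplant, multi-centred-Morawetz): - technique_class: N-body-scattering-transplant, multi-centred-Morawetz
- Literature.Barriers.FinalStateConjecture.SbierskiTrappingObstruction: applies (N photon regions +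
the inter-hole transfer set); evaded as the barrier's own evasions_known prescribe —
AdiabaticMultiKerrILED loses one derivative (E[∂ₜψ] on the right) and its glued multiplier must
DEGENERATE on the photon regions, never be strictly positive there; LinearToNonlinearCapture, the
target and OmegaLimitMultiKerr assert convergence / recurrence with no rate; RecedingDopplerBudget
is a classical statement about inter-zone TRANSFERS only (a ray parked at one photon sphere
contributes a single term), so single-hole trapping costs it nothing — consistent with the barrier,
which it does not claim to beat.
- Literature.Barriers.FinalStateConjecture.AretakisInstability: meets no active item after rev 11
(the extremal Majumdar–Papapetrou support item was dropped): the rank-2 crux and the Doppler budget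
carry |aᵢ| ≤ αMᵢ with α small existential, the target, LinearToNonlinearCapture and
OmegaLimitMultiKerr carry Kerr.IsSubextremal in hypothesis and conclusion, so the barrier's
technique class (uniform-in-spin up to |a| = M) is not entered; that generic data avoid extremal
LIMITS |aᵢ| → Mᵢ is part of the CONTENT of OmegaLimitMultiKerr (listed in its why-it-might-fail),
not a technique bet.
- Literature.Barriers.FinalStateConjecture.KerrSuperradiance: applies to the near zones (aᵢ ≠ 0
generically); the line inherits the sin

History (route lifecycle, newest last):
- 2026-08-16T03:51:55Z · AUTO-CRUX (edit): RecurrentMultiKerrCapture — hypotheses of the deciding theorem that nothing in the route derives are cruxes (planner-rchoice-FinalStateConjecture-ClusterCo-67c6c8a5-0)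
- 2026-08-16T04:22:29Z · rev 16: restated RecurrentMultiKerrCapture (stmt-FinalStateConjecture-10144), OmegaLimitMultiKerr (stmt-FinalStateConjecture-14312), RecurrentlyFlatDisperses (stmt-FinalStateConjecture-10147) — route-repair (rbadge gen 2), rev 16: INTERFACE REPAIR completing choice (a) 'add the remainder as a crux' honestly. The remain (planner-rbadge-FinalStateConjecture-ClusterCom-f0baa0d7-g2-0)
- 2026-08-16T04:30:14Z · rev 17: restated Assembly (stmt-FinalStateConjecture-14537) — route-repair (rbadge gen 2), rev 17: DECIDING-THEOREM SHAPE under the crux-only rule — `closes` now takes the route's genuine research cruxes (h₂ : AdiabaticMul (planner-rbadge-FinalStateConjecture-ClusterCom-f0baa0d7-g2-0)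
- 2026-08-16T07:30:05Z · rev 19: restated RecedingDopplerBudget (stmt-FinalStateConjecture-14311) — @edit_note.txt (planner-rbadge-FinalStateConjecture-ClusterCom-f0baa0d7-g3-0)
- 2026-08-16T23:24:55Z · rev 21: restated RecurrentMultiKerrCapture (stmt-FinalStateConjecture-14663), RecurrentlyFlatDisperses (stmt-FinalStateConjecture-14665), OmegaLimitMultiKerr (stmt-FinalStateConjecture-14664) — route-repair rev 21 (statement-revised, p126844 re-type T2): restated RecurrentMultiKerrCapture (X, target), RecurrentlyFlatDi (planner-rrepair-FinalStateConjecture-ClusterCo-dc8d11bd-0)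
- 2026-08-24T06:56:53Z · DORMANT — reconciler: no traction for 6.6 d (last activity item-evidence-added at 2026-08-17T16:29:57Z); parked, not closed — `ledger route dormant route-FinalStateConjec (operator:999:3857451)
- 2026-08-24T07:13:40Z · REACTIVATED — reconciler: reactivated — activity route-repaired at 2026-08-24T06:57:07Z after parking at 2026-08-24T06:56:53Z (operator:999:4150382)
- 2026-09-03T12:30:46Z · DORMANT — reconciler: no traction for 5 d (last activity statement-checked at 2026-08-29T11:45:39Z); parked, not closed — `ledger route dormant route-FinalStateConjecture (operator:999:2344497)

sub-problem: FinalStateConjecture · status: dormant · opened planner-plancard-FinalStateConjecture-FinalSt-b77e951f-0 2026-08-15T15:13:40Z · rev 21 · ledger route-FinalStateConjecture-ClusterCompleteness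
GENERATED by the gate from the ledger (D-0016/17). Provers cite these decls: `theorem foo : Summit.FinalStateConjecture.FinalStateConjecture.Theses.ClusterCompleteness.<Decl> := …` in Summits/FinalStateConjecture/FinalStateConjecture/Theorems/<Name>.lean.
-/

namespace Summit.FinalStateConjecture.FinalStateConjecture.Theses.ClusterCompleteness

open scoped BigOperators Topology Manifold Classical MeasureTheory ProbabilityTheory Matrix InnerProductSpace ComplexConjugate ContinuousMap ContDiff
open Filter Set Function TopologicalSpace MeasureTheory

attribute [summit_statement] _root_.FinalStateConjecture

open Literature.Geometry.Lorentzian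

-- earlier RecurrentMultiKerrCapture (stmt-FinalStateConjecture-10144, replaced 2026-08-16T04:22:29Z -> stmt-FinalStateConjecture-14663): retired by None — open Literature.Geometry.Lorentzian in open scoped ContDiff in ∃ k : ℕ, ∀ (X : Type) [TopologicalSpace X] [ChartedSpace E3 X] [IsManifold (𝓡 3) ∞ X] [T2Space X] [SecondCountableTopology X] [ConnectedSpace X], ∀ D ∈ admissibleVacuumData X, ∀ 𝒟 : Va
-- earlier RecurrentMultiKerrCapture (stmt-FinalStateConjecture-14663, replaced 2026-08-16T23:24:55Z -> stmt-FinalStateConjecture-17637): retired by None — open Literature.Geometry.Lorentzian in open scoped ContDiff in ∃ k : ℕ, ∀ (X : Type) [TopologicalSpace X] [ChartedSpace E3 X] [IsManifold (𝓡 3) ∞ X] [T2Space X] [SecondCountableTopology X] [ConnectedSpace X], ∀ D ∈ admissibleVacuumData X, ∀ 𝒟 : Va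
/-- item stmt-FinalStateConjecture-17637 · target · rank 0 · open · by planner
why it might fail: Even anchored and oriented, sup-norm recurrence gives no weighted control at one time: sup-small but energetic in-falling radiation can hide at large radius between recurrence times (o₂(r⁻¹) only); and N = 1 already contains sub-extremal Kerr stability for all |a| < M from a non-Cauchy hypothesis.
sources: Graf1990, SigalSoffer1987, Derezinski1993, GiorgiKlainermanSzeftel2022, KlainermanSzeftel2023, DafermosHolzegelRodnianskiTaylor2021
[target] X — ANCHORED, ORIENTED RECURRENT MULTI-KERR CAPTURE, re-typed at rev 21 for the Statement
revision T2 (p126844, 2026-08-16): the rev-16 anchored interface (F1 closeness to every fixed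
radius, F2 uniform C⁰ anchor, F3 separation; refuter's C′ after the `misstated` verdict on the
rev-11 form) is KEPT verbatim, three Statement-tracking clauses are ADDED to the hypothesis, and the
conclusion is the re-typed settle matrix verbatim. For some order k: every maximal vacuum Cauchy
development of admissible data which admits final-state-shaped late charts — N ≥ 0 hole charts Ψᵢ on
boosted sub-extremal Kerr exteriors and one flat chart Ψ₀ on the late half-space minus sublinear
tubes around the holes' straight world-lines, O = exteriorOf(charted), the holes separating for
every radius, exhaustion of O for EVERY τ₁ > τ₀ by certified near zones {rᵢ ≤ Rᵢ(τ)} and flat slabs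
with HONEST radii (Rᵢ → ∞ and Rᵢ(τ) ≥ max(r₊(Mᵢ,aᵢ),0) + 1 for all τ — the Statement's radii
conjunct: no truncated slab is empty, so the anchor bites at every late time), every future-complete
normalised null ray from Σ staying in closure O (`RaysStayInClosure 𝒟 O`, the Statement's intrinsic
lower bound: the charted r -/
@[route_item "route-FinalStateConjecture-ClusterCompleteness"]
def RecurrentMultiKerrCapture : Prop :=
  open Literature.Geometry.Lorentzian in open scoped ContDiff in ∃ k : ℕ, ∀ (X : Type) [TopologicalSpace X] [ChartedSpace E3 X] [IsManifold (𝓡 3) ∞ X] [T2Space X] [SecondCountableTopology X] [ConnectedSpace X], ∀ D ∈ admissibleVacuumData X, ∀ 𝒟 : VacuumCauchyDevelopment D, 𝒟.IsMaximal → (∃ (O : Set 𝒟.carrier) (N : ℕ) (M a : Fin N → ℝ) (mo : Fin N → lorentzGroup × E4) (τ₀ : ℝ) (Ψ : ∀ i, boostedKerrExterior (mo i).1 (mo i).2 (M i) (a i) → 𝒟.carrier) (ρ R : Fin N → ℝ → ℝ) (U₀ : Opens E4) (Ψ₀ : U₀ → 𝒟.carrier), (∀ i, Kerr.IsSubextremal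 (M i) (a i)) ∧ (∀ i, 𝒟.toSpacetime.IsLateChart (boostedKerrBackground (mo i).1 (mo i).2 (M i) (a i)) O τ₀ (Ψ i)) ∧ 𝒟.toSpacetime.IsLateChart (Minkowski.backgroundOn U₀) O τ₀ Ψ₀ ∧ (∀ i, Tendsto (fun t ↦ ρ i t / t) atTop (𝓝 0)) ∧ (∀ i, Tendsto (R i) atTop atTop ∧ ∀ τ, max (Kerr.rPlus (M i) (a i)) 0 + 1 ≤ R i τ) ∧ {x : E4 | τ₀ < x 0 ∧ ∀ i, ρ i (x 0) < Kerr.radius (a i) (poincareInv (mo i).1 (mo i).2 x)} ⊆ (U₀ : Set E4) ∧ (∀ R' : ℝ, ∃ τ₁ : ℝ, Pairwise (Function.onFun Disjoint fun i ↦ Ψ i '' (boostedKerrBackground (mo i).1 (mo i).2 (M i) (a i)).truncLateRegion τ₁ R')) ∧ O = Summit.FinalStateConjecture.exteriorOf 𝒟.toCauchyDevelopment ((⋃ i, Ψ i '' (boostedKerrBackground (mo i).1 (mo i).2 (M i) (a i)).lateRegion τ₀) ∪ Ψ₀ '' (Minkowski.backgroundOn U₀).lateRegion τ₀) ∧ Summit.FinalStateConjecture.RaysStayInClosure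 𝒟.toCauchyDevelopment O ∧ (∀ τ₁ : ℝ, τ₀ < τ₁ → O \ (Ψ₀ '' (Minkowski.backgroundOn U₀).lateRegion τ₁ ∪ ⋃ i, Ψ i '' {x | τ₁ < (boostedKerrBackground (mo i).1 (mo i).2 (M i) (a i)).time x.1 ∧ (boostedKerrBackground (mo i).1 (mo i).2 (M i) (a i)).radius x.1 ≤ R i ((boostedKerrBackground (mo i).1 (mo i).2 (M i) (a i)).time x.1)}) ⊆ 𝒟.metric.causalPast 𝒟.timeOrientation (Ψ₀ '' (Minkowski.backgroundOn U₀).timeSlab τ₁ ∪ ⋃ i, Ψ i '' (boostedKerrBackground (mo i).1 (mo i).2 (M i) (a i)).truncTimeSlab (R i τ₁) τ₁)) ∧ ((∀ i, Summit.FinalStateConjecture.IsOrthochronous (mo i).1) ∧ ∀ τ : ℝ, τ₀ < τ → ∀ x ∈ (Minkowski.backgroundOn U₀).timeSlab τ, 𝒟.toSpacetime.timeOrientation.IsFutureDirected (mfderiv 𝓘(ℝ, E4) (𝓡 4) Ψ₀ x (E4.basisVector 0))) ∧ (∀ τ : ℝ, τ₀ < τ → 𝒟.toSpacetime.deviationCk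 (Minkowski.backgroundOn U₀) Ψ₀ 0 τ ≤ ENNReal.ofReal (1 / 4) ∧ ∀ i, 𝒟.toSpacetime.truncDeviationCk (boostedKerrBackground (mo i).1 (mo i).2 (M i) (a i)) (Ψ i) 0 (R i τ) τ ≤ ENNReal.ofReal (1 / 4)) ∧ ∀ R' : ℝ, ∀ ε : ℝ, 0 < ε → ∃ᶠ τ in atTop, 𝒟.toSpacetime.deviationCk (Minkowski.backgroundOn U₀) Ψ₀ k τ ≤ ENNReal.ofReal ε ∧ ∀ i, 𝒟.toSpacetime.truncDeviationCk (boostedKerrBackground (mo i).1 (mo i).2 (M i) (a i)) (Ψ i) k R' τ ≤ ENNReal.ofReal ε ∧ ∀ x ∈ (boostedKerrBackground (mo i).1 (mo i).2 (M i) (a i)).truncTimeSlab R' τ, 𝒟.toSpacetime.timeOrientation.IsFutureDirected (mfderiv 𝓘(ℝ, E4) (𝓡 4) (Ψ i) x (((mo i).1 : E4 ≃L[ℝ] E4) (Kerr.timeVector (M i) (a i) (poincareInv (mo i).1 (mo i).2 (x : E4)))))) → (Summit.FinalStateConjecture.HasCompleteNullInfinity 𝒟.toCauchyDevelopment ∧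 ∃ (O : Set 𝒟.carrier) (d : FinalStateDecomposition 𝒟.toSpacetime O 2), (∀ i, Kerr.IsSubextremal (d.mass i) (d.spin i)) ∧ O = Summit.FinalStateConjecture.exteriorOf 𝒟.toCauchyDevelopment d.charted ∧ Summit.FinalStateConjecture.RaysStayInClosure 𝒟.toCauchyDevelopment O ∧ Summit.FinalStateConjecture.HasExhaustiveCharts d ∧ Summit.FinalStateConjecture.IsFutureOriented d)

-- earlier AdiabaticMultiKerrILED (stmt-FinalStateConjecture-10182, replaced 2026-08-15T22:02:18Z -> stmt-FinalStateConjecture-13854): retired by None — [crux] GRAF-GLUED MULTI-CENTRED MORAWETZ ON RECEDING MULTI-KERR BACKGROUNDS (card item (1), the line's decisive step; informal until the patched background is typed — see DEFINITION REQUESTS `PatchedMultiKerrBackground`). Background: the patched rece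
-- earlier AdiabaticMultiKerrILED (stmt-FinalStateConjecture-13854, replaced 2026-08-16T03:14:55Z -> stmt-FinalStateConjecture-14310): retired by None — open Literature.Geometry.Lorentzian in open scoped ContDiff in ∀ N : ℕ, ∃ d₀ α v₀ : ℝ, 0 < d₀ ∧ 0 < α ∧ 0 < v₀ ∧ ∀ (M a : Fin N → ℝ) (Λ : Fin N → lorentzGroup) (p : Fin N → E3) (u : Fin N → E4) (q : Fin N → E4 → E4), (∀ i, u i = (Λ i : E4 ≃L[ℝ] E4) (
/-- item stmt-FinalStateConjecture-14310 · crux · rank 2 · open · by planner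
why it might fail: Static limit is FALSE (reduced-elliptic twisted 4-bounce null orbits between two holes at every d ≥ 100M; evidence) ⇒ C↑∞ as Δv_min→0; no multiplier is positive on instantaneous islands, only Doppler redshift can give (b) — adiabatic beams with log-many reflections may beat any finite loss.
sources: Graf1990, arXiv:0811.0354, DafermosRodnianski2011, MetcalfeSterbenzTataru2017, TataruTohaneanu2010, Keir2016
[crux] RESTATED 2026-08-16 for cone hygiene only (`Kerr.etaComp μ ν` ↦ `Minkowski.bilin
(E4.basisVector μ) (E4.basisVector ν)`, `KerrSchild.waveOperator G ψ x` ↦ its defining sum Σ_μ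
∂_μ(Σ_ν G^{μν}∂_νψ)(x); the route then imports only the Statement's cone); EQUIVALENT to
stmt-FinalStateConjecture-13854 by the kernel certificate `adiabatic_restate_iff` (evidence
SketchEq.lean) — its crux-attack SURVIVES 22:33Z, grounding NEW 22:54Z and evidence files carry
over; 2026-08-15: refuted-misstated → C″. GRAF-GLUED MULTI-CENTRED ILED ON STRICTLY RECEDING,
TAILS-CUT PATCHED MULTI-KERR BACKGROUNDS (scalar waves). Background (inline coefficient field G, □_G
in divergence form): N boosted Kerr near zones in flat space, G = η⁻¹ − Σᵢ
χᵢ·2Hᵢ(qᵢx)·(Λᵢℓ♯ᵢ(qᵢx))⊗(Λᵢℓ♯ᵢ(qᵢx)), qᵢ = poincareInv Λᵢ (0,pᵢ), with the FIXED gentle step χᵢ =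
Real.smoothTransition(2 − rᵢ/8Mᵢ) (≡ 1 for rᵢ ≤ 8Mᵢ: exact boosted Kerr with Killing horizon,
redshift, ergoregion and photon region; ≡ 0 for rᵢ ≥ 16Mᵢ: exactly flat, tails cut; |χᵢ′| ≤ 1/(4Mᵢ)
since max smoothTransition′ = 2, so (1 − 2Mᵢχᵢ/r)/r² is strictly decreasing on [3Mᵢ, ∞): no annulus
well — the g0/g2 refutation witness χ(4M)=1, χ(4.5M)=0 is excluded by constru -/
@[route_item "route-FinalStateConjecture-ClusterCompleteness"]
def AdiabaticMultiKerrILED : Prop :=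
  ∀ N : ℕ, ∃ d₀ α v₀ : ℝ, 0 < d₀ ∧ 0 < α ∧ 0 < v₀ ∧ ∀ (M a : Fin N → ℝ) (Λ : Fin N → lorentzGroup) (p : Fin N → E3) (u : Fin N → E4) (q : Fin N → E4 → E4), (∀ i, u i = (Λ i : E4 ≃L[ℝ] E4) (E4.basisVector 0)) → (∀ i x, q i x = poincareInv (Λ i) (E4.ofTimeSpace 0 (p i)) x) → (∀ i, 0 < M i) → (∀ i, |a i| ≤ α * M i) → (∀ i, 0 < u i 0 ∧ ‖E4.spatial (u i)‖ ≤ v₀ * u i 0) → (∀ i j, i ≠ j → d₀ * (M i + M j) ≤ dist (p i) (p j) ∧ 0 < ⟪p i - p j, (u i 0)⁻¹ • E4.spatial (u i) - (u j 0)⁻¹ • E4.spatial (u j)⟫_ℝ) → ∀ (G : E4 → Fin 4 → Fin 4 → ℝ), (∀ x μ ν, G x μ ν = Minkowski.bilin (E4.basisVector μ) (E4.basisVector ν) - ∑ i, Real.smoothTransition (2 - Kerr.radius (a i) (q i x) / (8 * M i)) * (2 * Kerr.scalarH (M i) (a i) (q i x)) * ((Λ i : E4 ≃L[ℝ] E4)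 (Kerr.nullVector (a i) (q i x))) μ * ((Λ i : E4 ≃L[ℝ] E4) (Kerr.nullVector (a i) (q i x))) ν) → ∀ (E : (E4 → ℝ) → ℝ → ENNReal), (∀ φ t, E φ t = ∫⁻ y in {y : E3 | ∀ i, Kerr.rPlus (M i) (a i) < Kerr.radius (a i) (q i (E4.ofTimeSpace t y))}, ENNReal.ofReal (∑ μ : Fin 4, (fderiv ℝ φ (E4.ofTimeSpace t y) (E4.basisVector μ)) ^ 2)) → ∀ R : ℝ, ∃ C : NNReal, ∀ ψ : E4 → ℝ, ContDiff ℝ ∞ ψ → (∀ x : E4, 0 ≤ x 0 → (∀ i, Kerr.rPlus (M i) (a i) < Kerr.radius (a i) (q i x)) → ∑ μ : Fin 4, fderiv ℝ (fun y ↦ ∑ ν : Fin 4, G y μ ν * fderiv ℝ ψ y (E4.basisVector ν)) x (E4.basisVector μ) = 0) → (∀ t : ℝ, 0 ≤ t → E ψ t ≤ (C : ENNReal) * E ψ 0) ∧ ∫⁻ t in Set.Ioi (0 : ℝ), ∫⁻ y in {y : E3 | ‖y‖ ≤ R ∧ ∀ i, Kerr.rPlus (M i) (a i) < Kerr.radius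 (a i) (q i (E4.ofTimeSpace t y))}, ENNReal.ofReal (∑ μ : Fin 4, (fderiv ℝ ψ (E4.ofTimeSpace t y) (E4.basisVector μ)) ^ 2) ≤ (C : ENNReal) * (E ψ 0 + E (fun x ↦ fderiv ℝ ψ x (E4.basisVector 0)) 0)

-- earlier LinearToNonlinearCapture (stmt-FinalStateConjecture-14313, replaced 2026-08-16T03:31:03Z -> stmt-FinalStateConjecture-14526): retired by None — AdiabaticMultiKerrILED → RecurrentlyFlatDisperses → RecurrentMultiKerrCapture
/-- item stmt-FinalStateConjecture-14526 · crux · rank 3 · open · by planner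
why it might fail: Granted #2: tensorial (Teukolsky) estimates on non-type-D glued annuli, nonlinear closure with a derivative loss at trapping, weighted smallness manufactured from anchored sup-norm recurrence (N = 0 already below CK smallness), and spins αMᵢ < |aᵢ| < Mᵢ where #2 gives nothing.
sources: GiorgiKlainermanSzeftel2022, KlainermanSzeftel2023, DafermosHolzegelRodnianskiTaylor2021, arXiv:2205.14808, arXiv:0811.0354, arXiv:2302.08916
[crux] LINEAR-TO-NONLINEAR CAPTURE — the layer-2 glue of the target, filed at rev 11 as a crux (the
gate requires the target to be concluded by items; its content is a research obstruction, not
routine glue; rev 12: the N = 0 hypothesis removed so that the decl elaborates before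
RecurrentlyFlatDisperses in the rendered file — #5 stays the N = 0 SUB-CASE of both X and this item,
an early warning rather than an input): the late-phase engine of this line — uniform energy
boundedness + integrated local energy decay with loss of one derivative for scalar waves on every
strictly receding, tails-cut patched multi-Kerr background (AdiabaticMultiKerrILED) — implies X =
RecurrentMultiKerrCapture: every maximal vacuum development of admissible data that recurs in Cᵏ
(sup-norm, on exhaustive final-state-shaped charts) to a receding sub-extremal multi-Kerr
configuration has complete 𝓘⁺ and settles down in the sense of the Statement. Statement: the
implication AdiabaticMultiKerrILED → RecurrentMultiKerrCapture between route decls (pure Prop arrow;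
the work is the upgrade). CONTENT: (i) TeukolskyUpgrade — the same glued, time-dependent
multi-centred multiplier/commutator estimates for the lineari -/
@[route_item "route-FinalStateConjecture-ClusterCompleteness"]
def LinearToNonlinearCapture : Prop :=
  AdiabaticMultiKerrILED → RecurrentMultiKerrCapture

-- earlier RecurrentlyFlatDisperses (stmt-FinalStateConjecture-10147, replaced 2026-08-16T04:22:29Z -> stmt-FinalStateConjecture-14665): retired by None — open Literature.Geometry.Lorentzian in open scoped ContDiff in ∃ k : ℕ, ∀ (X : Type) [TopologicalSpace X] [ChartedSpace E3 X] [IsManifold (𝓡 3) ∞ X] [T2Space X] [SecondCountableTopology X] [ConnectedSpace X], ∀ D ∈ admissibleVacuumData X, ∀ 𝒟 : Vac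
-- earlier RecurrentlyFlatDisperses (stmt-FinalStateConjecture-14665, replaced 2026-08-16T23:24:55Z -> stmt-FinalStateConjecture-17638): retired by None — open Literature.Geometry.Lorentzian in open scoped ContDiff in ∃ k : ℕ, ∀ (X : Type) [TopologicalSpace X] [ChartedSpace E3 X] [IsManifold (𝓡 3) ∞ X] [T2Space X] [SecondCountableTopology X] [ConnectedSpace X], ∀ D ∈ admissibleVacuumData X, ∀ 𝒟 : Vac
/-- item stmt-FinalStateConjecture-17638 · crux · rank 5 · open · by planner
why it might fail: ∀ data, unweighted: needs Minkowski stability from sup-norm slab flatness far below CK/LR/Bieri weighted smallness plus exclusion of recurrent non-decaying AF vacuum ends; one admissible MGHD recurrently sup-flat on anchored oriented entire slabs yet not settling refutes it.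
sources: ChristodoulouKlainerman1993, Bieri2010JDG, LindbladRodnianski2010, AlexakisSchlue2018, Christodoulou1999, arXiv:0811.0354
[crux] The N = 0 instance of X (certificate x_imp_b : RecurrentMultiKerrCapture →
RecurrentlyFlatDisperses via recurs_of_recursFlat, Sketch.lean rc 0), re-typed with X at rev 21 for
the Statement revision T2 (p126844): a maximal vacuum Cauchy development of admissible data carrying
a flat late chart Ψ₀ on the WHOLE late half-space {x⁰ > τ₀} ⊆ U₀ — O = exteriorOf of its image; the
uncharted part of O causally below every slab (exhaustion for every τ₁ > τ₀); every future-complete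
normalised null ray from Σ stays in closure O (`RaysStayInClosure`, the Statement's intrinsic lower
bound on the charted region); chart time future-oriented — the push-forward of ∂₀ under Ψ₀ is
future-directed causal at every point of every late slab (timelike is automatic from the anchor, the
sign is the content); C⁰ deviation ≤ 1/4 on EVERY late slab, so each slab is an entire spacelike,
future-oriented almost-flat hypersurface through the middle, never a far-exterior, lagging or
time-reversed leaf — on which Cᵏ-flatness ≤ ε recurs on whole slabs at arbitrarily late times for
every ε > 0, has complete 𝓘⁺ and settles down in the sense of the re-typed Statement (∃ O′ d,
sub-extremal holes, O′ = exteriorOf d. -/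
@[route_item "route-FinalStateConjecture-ClusterCompleteness"]
def RecurrentlyFlatDisperses : Prop :=
  open Literature.Geometry.Lorentzian in open scoped ContDiff in ∃ k : ℕ, ∀ (X : Type) [TopologicalSpace X] [ChartedSpace E3 X] [IsManifold (𝓡 3) ∞ X] [T2Space X] [SecondCountableTopology X] [ConnectedSpace X], ∀ D ∈ admissibleVacuumData X, ∀ 𝒟 : VacuumCauchyDevelopment D, 𝒟.IsMaximal → (∃ (O : Set 𝒟.carrier) (τ₀ : ℝ) (U₀ : Opens E4) (Ψ₀ : U₀ → 𝒟.carrier), 𝒟.toSpacetime.IsLateChart (Minkowski.backgroundOn U₀) O τ₀ Ψ₀ ∧ {x : E4 | τ₀ < x 0} ⊆ (U₀ : Set E4) ∧ O = Summit.FinalStateConjecture.exteriorOf 𝒟.toCauchyDevelopment (Ψ₀ '' (Minkowski.backgroundOn U₀).lateRegion τ₀) ∧ Summit.FinalStateConjecture.RaysStayInClosure 𝒟.toCauchyDevelopment O ∧ (∀ τ₁ : ℝ, τ₀ < τ₁ → O \ Ψ₀ '' (Minkowski.backgroundOn U₀).lateRegion τ₁ ⊆ 𝒟.metric.causalPast 𝒟.timeOrientation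 (Ψ₀ '' (Minkowski.backgroundOn U₀).timeSlab τ₁)) ∧ (∀ τ : ℝ, τ₀ < τ → ∀ x ∈ (Minkowski.backgroundOn U₀).timeSlab τ, 𝒟.toSpacetime.timeOrientation.IsFutureDirected (mfderiv 𝓘(ℝ, E4) (𝓡 4) Ψ₀ x (E4.basisVector 0))) ∧ (∀ τ : ℝ, τ₀ < τ → 𝒟.toSpacetime.deviationCk (Minkowski.backgroundOn U₀) Ψ₀ 0 τ ≤ ENNReal.ofReal (1 / 4)) ∧ ∀ ε : ℝ, 0 < ε → ∃ᶠ τ in atTop, 𝒟.toSpacetime.deviationCk (Minkowski.backgroundOn U₀) Ψ₀ k τ ≤ ENNReal.ofReal ε) → (Summit.FinalStateConjecture.HasCompleteNullInfinity 𝒟.toCauchyDevelopment ∧ ∃ (O : Set 𝒟.carrier) (d : FinalStateDecomposition 𝒟.toSpacetime O 2), (∀ i, Kerr.IsSubextremal (d.mass i) (d.spin i)) ∧ O = Summit.FinalStateConjecture.exteriorOf 𝒟.toCauchyDevelopment d.charted ∧ Summit.FinalStateConjecture.RaysStayInClosure 𝒟.toCauchyDevelopment O ∧ Summit.FinalStateConjecture.HasExhaustiveCharts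 d ∧ Summit.FinalStateConjecture.IsFutureOriented d)

-- earlier OmegaLimitMultiKerr (stmt-FinalStateConjecture-10148, replaced 2026-08-16T03:14:55Z -> stmt-FinalStateConjecture-14312): retired by None — open Literature.Geometry.Lorentzian in open scoped ContDiff in ∀ (k : ℕ) (X : Type) [TopologicalSpace X] [ChartedSpace E3 X] [IsManifold (𝓡 3) ∞ X] [T2Space X] [SecondCountableTopology X] [ConnectedSpace X], InitialDataSet.IsChristodoulouGeneric (admiss
-- earlier OmegaLimitMultiKerr (stmt-FinalStateConjecture-14312, replaced 2026-08-16T04:22:29Z -> stmt-FinalStateConjecture-14664): retired by None — ∀ (k : ℕ) (X : Type) [TopologicalSpace X] [ChartedSpace E3 X] [IsManifold (𝓡 3) ∞ X] [T2Space X] [SecondCountableTopology X] [ConnectedSpace X], InitialDataSet.IsChristodoulouGeneric (admissibleVacuumData X) (fun D ↦ (∃ 𝒟 : VacuumCauchyDevelopment D, 𝒟.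
-- earlier OmegaLimitMultiKerr (stmt-FinalStateConjecture-14664, replaced 2026-08-16T23:24:55Z -> stmt-FinalStateConjecture-17639): retired by None — open Literature.Geometry.Lorentzian in open scoped ContDiff in ∀ (k : ℕ) (X : Type) [TopologicalSpace X] [ChartedSpace E3 X] [IsManifold (𝓡 3) ∞ X] [T2Space X] [SecondCountableTopology X] [ConnectedSpace X], InitialDataSet.IsChristodoulouGeneric (admiss
/-- item stmt-FinalStateConjecture-17639 · crux · rank 9 · open · by planner
why it might fail: Only with the Statement (which implies it): generic data whose MGHDs neither settle nor recur with anchored oriented ray-complete charts — incomplete 𝓘⁺, eternal bound/chaotic motion, extremal limits, non-Kerr ends, complete null rays inside black holes; misstatement risk in the clauses at large k.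
sources: DafermosLuk2017, Christodoulou1999, Penrose1982, Klainerman2025, AlexakisSchlue2018, arXiv:1205.6112
[crux] GENERIC ω-LIMIT DICHOTOMY, ANCHORED AND ORIENTED — the pre-phase of the summit, claimed by
this route since rev 11, interface repaired at rev 16 per the refuter's C′ (F1 closeness to every
fixed radius, F2 uniform C⁰ anchor, F3 separation), RE-TYPED at rev 21 for the Statement revision T2
(p126844, 2026-08-16): (T) genericity is the TAME notion `InitialDataSet.IsTameChristodoulouGeneric
… 1` — the witness family through an exceptional datum lives on ONE fixed asymptotically flat end e
of Σ (DR rates, continuous mass), is jointly smooth, wDist-continuous at c = 0 and immersed at 0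
(burial families of divergent mass are no longer witnesses); (S) the negated settle matrix is the
re-typed one (complete 𝓘⁺ ∧ ∃ O d, sub-extremal ∧ O = exteriorOf d.charted ∧ RaysStayInClosure O ∧
HasExhaustiveCharts d with honest radii ∧ IsFutureOriented d); (R) the recur-disjunct is the
hypothesis of RecurrentMultiKerrCapture VERBATIM: the rev-16 anchored interface plus honest radii
Rᵢ(τ) ≥ max(r₊,0) + 1 with Rᵢ → ∞, RaysStayInClosure of the charted exterior O, orthochronous
motions Λᵢ with the flat chart's ∂₀ pushed forward future-directed on every late flat slab, and — at
the recurrence times, t -/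
@[route_item "route-FinalStateConjecture-ClusterCompleteness"]
def OmegaLimitMultiKerr : Prop :=
  open Literature.Geometry.Lorentzian in open scoped ContDiff in ∀ (k : ℕ) (X : Type) [TopologicalSpace X] [ChartedSpace E3 X] [IsManifold (𝓡 3) ∞ X] [T2Space X] [SecondCountableTopology X] [ConnectedSpace X], InitialDataSet.IsTameChristodoulouGeneric (admissibleVacuumData X) (fun D ↦ (∃ 𝒟 : VacuumCauchyDevelopment D, 𝒟.IsMaximal) ∧ ∀ 𝒟 : VacuumCauchyDevelopment D, 𝒟.IsMaximal → ¬ (Summit.FinalStateConjecture.HasCompleteNullInfinity 𝒟.toCauchyDevelopment ∧ ∃ (O : Set 𝒟.carrier) (d : FinalStateDecomposition 𝒟.toSpacetime O 2), (∀ i, Kerr.IsSubextremal (d.mass i) (d.spin i)) ∧ O = Summit.FinalStateConjecture.exteriorOf 𝒟.toCauchyDevelopment d.charted ∧ Summit.FinalStateConjecture.RaysStayInClosure 𝒟.toCauchyDevelopment O ∧ Summit.FinalStateConjecture.HasExhaustiveCharts d ∧ Summit.FinalStateConjecture.IsFutureOriented d) → ∃ (O : Set 𝒟.carrier) (N : ℕ)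 (M a : Fin N → ℝ) (mo : Fin N → lorentzGroup × E4) (τ₀ : ℝ) (Ψ : ∀ i, boostedKerrExterior (mo i).1 (mo i).2 (M i) (a i) → 𝒟.carrier) (ρ R : Fin N → ℝ → ℝ) (U₀ : Opens E4) (Ψ₀ : U₀ → 𝒟.carrier), (∀ i, Kerr.IsSubextremal (M i) (a i)) ∧ (∀ i, 𝒟.toSpacetime.IsLateChart (boostedKerrBackground (mo i).1 (mo i).2 (M i) (a i)) O τ₀ (Ψ i)) ∧ 𝒟.toSpacetime.IsLateChart (Minkowski.backgroundOn U₀) O τ₀ Ψ₀ ∧ (∀ i, Tendsto (fun t ↦ ρ i t / t) atTop (𝓝 0)) ∧ (∀ i, Tendsto (R i) atTop atTop ∧ ∀ τ, max (Kerr.rPlus (M i) (a i)) 0 + 1 ≤ R i τ) ∧ {x : E4 | τ₀ < x 0 ∧ ∀ i, ρ i (x 0) < Kerr.radius (a i) (poincareInv (mo i).1 (mo i).2 x)} ⊆ (U₀ : Set E4) ∧ (∀ R' : ℝ, ∃ τ₁ : ℝ, Pairwise (Function.onFun Disjoint fun i ↦ Ψ i '' (boostedKerrBackground (mo i).1 (mo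 i).2 (M i) (a i)).truncLateRegion τ₁ R')) ∧ O = Summit.FinalStateConjecture.exteriorOf 𝒟.toCauchyDevelopment ((⋃ i, Ψ i '' (boostedKerrBackground (mo i).1 (mo i).2 (M i) (a i)).lateRegion τ₀) ∪ Ψ₀ '' (Minkowski.backgroundOn U₀).lateRegion τ₀) ∧ Summit.FinalStateConjecture.RaysStayInClosure 𝒟.toCauchyDevelopment O ∧ (∀ τ₁ : ℝ, τ₀ < τ₁ → O \ (Ψ₀ '' (Minkowski.backgroundOn U₀).lateRegion τ₁ ∪ ⋃ i, Ψ i '' {x | τ₁ < (boostedKerrBackground (mo i).1 (mo i).2 (M i) (a i)).time x.1 ∧ (boostedKerrBackground (mo i).1 (mo i).2 (M i) (a i)).radius x.1 ≤ R i ((boostedKerrBackground (mo i).1 (mo i).2 (M i) (a i)).time x.1)}) ⊆ 𝒟.metric.causalPast 𝒟.timeOrientation (Ψ₀ '' (Minkowski.backgroundOn U₀).timeSlab τ₁ ∪ ⋃ i, Ψ i '' (boostedKerrBackground (mo i).1 (mo i).2 (M i) (a i)).truncTimeSlab (R i τ₁) τ₁)) ∧ ((∀ i, Summit.FinalStateConjecture.IsOrthochronous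 (mo i).1) ∧ ∀ τ : ℝ, τ₀ < τ → ∀ x ∈ (Minkowski.backgroundOn U₀).timeSlab τ, 𝒟.toSpacetime.timeOrientation.IsFutureDirected (mfderiv 𝓘(ℝ, E4) (𝓡 4) Ψ₀ x (E4.basisVector 0))) ∧ (∀ τ : ℝ, τ₀ < τ → 𝒟.toSpacetime.deviationCk (Minkowski.backgroundOn U₀) Ψ₀ 0 τ ≤ ENNReal.ofReal (1 / 4) ∧ ∀ i, 𝒟.toSpacetime.truncDeviationCk (boostedKerrBackground (mo i).1 (mo i).2 (M i) (a i)) (Ψ i) 0 (R i τ) τ ≤ ENNReal.ofReal (1 / 4)) ∧ ∀ R' : ℝ, ∀ ε : ℝ, 0 < ε → ∃ᶠ τ in atTop, 𝒟.toSpacetime.deviationCk (Minkowski.backgroundOn U₀) Ψ₀ k τ ≤ ENNReal.ofReal ε ∧ ∀ i, 𝒟.toSpacetime.truncDeviationCk (boostedKerrBackground (mo i).1 (mo i).2 (M i) (a i)) (Ψ i) k R' τ ≤ ENNReal.ofReal ε ∧ ∀ x ∈ (boostedKerrBackground (mo i).1 (mo i).2 (M i) (a i)).truncTimeSlab R' τ,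 𝒟.toSpacetime.timeOrientation.IsFutureDirected (mfderiv 𝓘(ℝ, E4) (𝓡 4) (Ψ i) x (((mo i).1 : E4 ≃L[ℝ] E4) (Kerr.timeVector (M i) (a i) (poincareInv (mo i).1 (mo i).2 (x : E4)))))) 1

-- earlier RecedingDopplerBudget (stmt-FinalStateConjecture-13921, replaced 2026-08-16T03:14:55Z -> stmt-FinalStateConjecture-14311): retired by None — open Literature.Geometry.Lorentzian in open scoped ContDiff in ∀ N : ℕ, ∃ d₀ α v₀ : ℝ, 0 < d₀ ∧ 0 < α ∧ 0 < v₀ ∧ ∀ (M a : Fin N → ℝ) (Λ : Fin N → lorentzGroup) (p : Fin N → E3) (u : Fin N → E4) (q : Fin N → E4 → E4), (∀ i, u i = (Λ i : E4 ≃L[ℝ] E4) (E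
-- earlier RecedingDopplerBudget (stmt-FinalStateConjecture-14311, replaced 2026-08-16T07:30:05Z -> stmt-FinalStateConjecture-15025): retired by None — ∀ N : ℕ, ∃ d₀ α v₀ : ℝ, 0 < d₀ ∧ 0 < α ∧ 0 < v₀ ∧ ∀ (M a : Fin N → ℝ) (Λ : Fin N → lorentzGroup) (p : Fin N → E3) (u : Fin N → E4) (q : Fin N → E4 → E4), (∀ i, u i = (Λ i : E4 ≃L[ℝ] E4) (E4.basisVector 0)) → (∀ i x, q i x = poincareInv (Λ i) (E4.ofTim
/-- item stmt-FinalStateConjecture-15025 · support · rank 9 · open · by planner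
[support] CLASSICAL DOPPLER BUDGET — REPAIRED C′ (rev 19, 2026-08-16; 1:1 restate of
stmt-FinalStateConjecture-14311 after the operator-relayed crux-attack readback 05:54Z, class
misstated: the ray's START TIME `x 0 0` was unconstrained while pairwise strict recession is imposed
at t = 0 only, so rays launched in the pre-receding era t ≪ 0 between then-APPROACHING holes
Fermi-accelerate, E·L ≈ const, and no C exists for the fixed configuration; C′ inserts the binder `0
≤ x 0 0` — launch in the receding era, future-directedness then keeps the ray there, matching the
rank-2 crux's {0 ≤ x⁰} — immediately after `0 < -(ξ 0 0)`; filed ⇒ C′ (certificate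
repaired_of_filed, Sketch.lean rc 0); grounding g39-14 (NEW as a stated theorem, folklore as a
mechanism) was written for C′ and carries over; earlier history: rev-11 cone-hygiene restatement of
stmt-13921, `doppler_restate_iff`, readback g47-1, DOPPLER_BUDGET_MEMO.md) — the geometric-optics
skeleton of AdiabaticMultiKerrILED (b), on the SAME background (hypotheses and inline inverse metric
G copied verbatim from the rank-2 crux: N boosted Kerr near zones in flat space, tails cut by the
fixed step smoothTransition(2 − rᵢ/8Mᵢ), |aᵢ| ≤ αMᵢ, -/
@[route_item "route-FinalStateConjecture-ClusterCompleteness"]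
def RecedingDopplerBudget : Prop :=
  ∀ N : ℕ, ∃ d₀ α v₀ : ℝ, 0 < d₀ ∧ 0 < α ∧ 0 < v₀ ∧ ∀ (M a : Fin N → ℝ) (Λ : Fin N → lorentzGroup) (p : Fin N → E3) (u : Fin N → E4) (q : Fin N → E4 → E4), (∀ i, u i = (Λ i : E4 ≃L[ℝ] E4) (E4.basisVector 0)) → (∀ i x, q i x = poincareInv (Λ i) (E4.ofTimeSpace 0 (p i)) x) → (∀ i, 0 < M i) → (∀ i, |a i| ≤ α * M i) → (∀ i, 0 < u i 0 ∧ ‖E4.spatial (u i)‖ ≤ v₀ * u i 0) → (∀ i j, i ≠ j → d₀ * (M i + M j) ≤ dist (p i) (p j) ∧ 0 < ⟪p i - p j, (u i 0)⁻¹ • E4.spatial (u i) - (u j 0)⁻¹ • E4.spatial (u j)⟫_ℝ) → ∀ (G : E4 → Fin 4 → Fin 4 → ℝ), (∀ x μ ν, G x μ ν = Minkowski.bilin (E4.basisVector μ) (E4.basisVector ν) - ∑ i, Real.smoothTransition (2 - Kerr.radius (a i) (q i x) / (8 * M i)) * (2 * Kerr.scalarH (M i) (a i) (q i x)) * ((Λ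 i : E4 ≃L[ℝ] E4) (Kerr.nullVector (a i) (q i x))) μ * ((Λ i : E4 ≃L[ℝ] E4) (Kerr.nullVector (a i) (q i x))) ν) → ∃ C : NNReal, ∀ (S : ℝ) (x ξ : ℝ → E4), (∀ s ∈ Set.Icc 0 S, ∀ i, Kerr.rPlus (M i) (a i) < Kerr.radius (a i) (q i (x s))) → (∀ s ∈ Set.Icc 0 S, ∀ μ : Fin 4, HasDerivAt (fun σ ↦ x σ μ) (∑ ν, G (x s) μ ν * ξ s ν) s) → (∀ s ∈ Set.Icc 0 S, ∀ κ : Fin 4, HasDerivAt (fun σ ↦ ξ σ κ) (-(1 / 2) * ∑ μ, ∑ ν, fderiv ℝ (fun y ↦ G y μ ν) (x s) (E4.basisVector κ) * ξ s μ * ξ s ν) s) → ∑ μ, ∑ ν, G (x 0) μ ν * ξ 0 μ * ξ 0 ν = 0 → (∀ i, 16 * M i ≤ Kerr.radius (a i) (q i (x 0))) → 0 < -(ξ 0 0) → 0 ≤ x 0 0 → (∀ s ∈ Set.Icc 0 S, (∀ i, 16 * M i ≤ Kerr.radius (a i) (q i (x s))) → -(ξ s 0) ≤ (C : ℝ) *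 -(ξ 0 0)) ∧ ∀ (n : ℕ) (t : Fin (n + 1) → ℝ) (ι : Fin (n + 1) → Fin N), StrictMono t → (∀ k, t k ∈ Set.Icc 0 S) → (∀ k : Fin n, ι k.castSucc ≠ ι k.succ) → (∀ k, Kerr.radius (a (ι k)) (q (ι k) (x (t k))) ≤ 16 * M (ι k)) → ∑ k, -(∑ μ, ξ (t k) μ * u (ι k) μ) ≤ (C : ℝ) * -(ξ 0 0)

-- earlier Assembly (stmt-FinalStateConjecture-10149, replaced 2026-08-16T03:16:22Z -> stmt-FinalStateConjecture-14345): retired by None — RecurrentMultiKerrCapture → OmegaLimitMultiKerr → FinalStateConjecture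
-- earlier Assembly (stmt-FinalStateConjecture-14345, replaced 2026-08-16T03:23:00Z -> stmt-FinalStateConjecture-14413): retired by None — RecurrentMultiKerrCapture → GenericMultiKerrRecurrence → MGHDExists → FinalStateConjecture
-- earlier Assembly (stmt-FinalStateConjecture-14413, replaced 2026-08-16T03:44:44Z -> stmt-FinalStateConjecture-14537): retired by None — RecurrentMultiKerrCapture → MGHDExists → GenericMultiKerrRecurrence → FinalStateConjecture
-- earlier Assembly (stmt-FinalStateConjecture-14537, replaced 2026-08-16T04:30:14Z -> stmt-FinalStateConjecture-14677): retired by None — RecurrentMultiKerrCapture → OmegaLimitMultiKerr → FinalStateConjecture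
/-- item stmt-FinalStateConjecture-14677 · assembly · rank 1 · closed · proved by Summit.FinalStateConjecture.FinalStateConjecture.Theorems.ClusterCompleteness.assembly_frame_proof (prover) · by planner
sources: Graf1990, DafermosLuk2017
[assembly] AdiabaticMultiKerrILED → LinearToNonlinearCapture → OmegaLimitMultiKerr →
FinalStateConjecture — literally the type of the deciding theorem `closes` (rev 17): the engine
(#2), the upgrade (#3 := #2 → X) and the anchored generic ω-limit dichotomy (#9) decide the
Statement; X = RecurrentMultiKerrCapture is DERIVED inside `closes` as `h₃ h₂` and is the route's
TARGET (refuter-vetted, not prover-staffed). Proof: obtain k from X; OmegaLimitMultiKerr k gives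
Christodoulou-genericity of '(∃ MGHD) ∧ ∀ MGHD, ¬Settles → Recurs_k'; X makes '¬Settles ∧ Recurs_k'
contradictory for every MGHD; genericity is monotone in the property (the same one-parameter family
through an exceptional datum works). Nine lines of logic; certified (Sketch.lean closes17 /
assembly17_holds, rc 0; native preview h21_check_closes ok). -/
@[route_item "route-FinalStateConjecture-ClusterCompleteness"]
def Assembly : Prop :=
  AdiabaticMultiKerrILED → LinearToNonlinearCapture → OmegaLimitMultiKerr → FinalStateConjecture

/-- `Assembly` holds: proved by `Summit.FinalStateConjecture.FinalStateConjecture.Theorems.ClusterCompleteness.assembly_frame_proof`. -/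
theorem Assembly_holds : Assembly := _root_.Summit.FinalStateConjecture.FinalStateConjecture.Theorems.ClusterCompleteness.assembly_frame_proof

-- records of items no longer active in this route (dropped / restated):
-- earlier MajumdarPapapetrouMorawetz (stmt-FinalStateConjecture-10145, replaced 2026-08-15T16:21:54Z -> stmt-FinalStateConjecture-10719): retired by None — open Literature.Geometry.Lorentzian in open scoped ContDiff in ∃ d₀ : ℝ, ∀ (N : ℕ) (M : Fin N → ℝ) (c : Fin N → E3), (∀ i, 0 < M i) → (∀ i j, i ≠ j → d₀ * (M i + M j) ≤ dist (c i) (c j)) → ∀ (Rb ρ₀ : ℝ), 0 < ρ₀ → ∃ C : NNReal, ∀ u : E4 → ℝ, ContD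

/-! D-0027 §2.1 — DECIDING THEOREM (planner-authored via `route open/edit --closes-file`; by planner-rrepair-FinalStateConjecture-ClusterCo-dc8d11bd-0 2026-08-16T23:24:55Z):
its hypotheses are this route's items and its conclusion the sub-problem Statement (glue_lint), and it elaborates with this file. -/

@[closes "route-FinalStateConjecture-ClusterCompleteness"] theorem closes (h₂ : AdiabaticMultiKerrILED) (h₃ : LinearToNonlinearCapture) (h₉ : OmegaLimitMultiKerr) :
    FinalStateConjecture := by
  obtain ⟨k, hk⟩ := h₃ h₂
  intro X _ _ _ _ _ _ d hd
  obtain ⟨e, F, hF, hI, h0, hinj, hD, hE⟩ := h₉ k X d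
    ⟨hd.1, fun hp ↦ hd.2 ⟨hp.1, fun 𝒟 hmax ↦ Classical.byContradiction fun hS ↦
      hS (hk X d hd.1 𝒟 hmax (hp.2 𝒟 hmax hS))⟩⟩
  exact ⟨e, F, hF, hI, h0, hinj, hD, fun c hc hmem ↦
    hE c hc ⟨hmem.1, fun hp ↦ hmem.2 ⟨hp.1, fun 𝒟 hmax ↦ Classical.byContradiction fun hS ↦
      hS (hk X _ hmem.1 𝒟 hmax (hp.2 𝒟 hmax hS))⟩⟩⟩

end Summit.FinalStateConjecture.FinalStateConjecture.Theses.ClusterCompleteness
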